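import Summits.Schanuel.Schanuel.Theorems.ZilberEacQuadraticLogRelations
import Summits.Schanuel.Schanuel.Theorems.ZilberEacResonantTranscendence
import Summits.Schanuel.Schanuel.Theorems.ZilberEacLogTranscendence
import HarnessLib

/-!
# The equimodular class, XLI: an ALGEBRAIC primitive of `ρ'/ρ` (`ρ` an algebraic branch of any
# degree) satisfies a polynomial identity along the branch — the minimal relation over `ℂ[z, ρ]`

HONEST FRAMING.  Cell `pub-schanuel` (Zilber's Exponential-Algebraic Closedness, case ladder;
host summit Schanuel), seat 2, gen 25.  The reduction step of the transcendence of the logarithm of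
an algebraic branch of ARBITRARY degree (the reciprocal-type fibres of `y₀`-degree `≥ 3`, the
residual of THEOREM EB and of the quadratic theorem of gen 24).  Let `ρ, L` be analytic at `z₀`,
`ρ(z₀) ≠ 0`, `Q(z, ρ z) = 0` near `z₀` (`Q ∈ ℂ[s][t]`) and `L' = ρ'/ρ` near `z₀`, and suppose a nonzero
`H ∈ ℂ[s][t]` has `H(z, L z) = 0` near `z₀`.  Then **`exists_logRelation_of_algebraic`**: there are
`F, G ∈ ℂ[s][t]` and `M ≥ 1` with `G(z, ρ z) ≢ 0` near `z₀` and, near `z₀`, `R(z, ρ z) = 0` for the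
explicit polynomial
`R = G·(t·(∂_sF·∂_tQ - ∂_tF·∂_sQ) - M·∂_sQ·G) - t·(∂_sG·∂_tQ - ∂_tG·∂_sQ)·F`
(so that, along ANY branch `y` of `Q = 0` with `∂_tQ(z, y) ≠ 0`, `(F(z,y)/G(z,y))' = -M·y'/y`:
`L = -F/(M G) + const` lies in `ℂ(z, ρ)`).  Proof: a relation `P(L) = 0` of minimal degree `M` over
the subalgebra `B = ℂ[zGerm, ρ̂]` of germs, which is stable under the derivation
`δ = ρ̂·∂_tQ(ρ̂)·d/dz` (`∂_tQ(ρ̂)·ρ̂' = -∂_sQ(ρ̂)`), differentiated: the combination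
`p_M(P^δ + δL·P') - δ(p_M)·P` has degree `< M`, hence vanishes; its `t^{M-1}`-coefficient is the
identity.  Also the chain rule **`hasDerivAt_evalPP`** and its germ form **`AGerm.D_germEval₂`**.
[folklore differential algebra (Liouville–Ostrowski), made concrete]; nothing here is specific to
Schanuel's conjecture (neither used nor implied); Mantova–Masser's question (PLMS 2024 §1 p. 5) and
EC(3,2) stay OPEN.
-/

noncomputable section

open Filter Topology Polynomial

set_option linter.dupNamespace false

namespace Summit.Schanuel.Schanuel.Theorems

/-! ## Part A. The chain rule for `z ↦ F(z, f z)` -/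

/-- Coefficients of `coeffDeriv`. [folklore] -/
theorem coeff_coeffDeriv (H : ℂ[X][X]) (j : ℕ) : (coeffDeriv H).coeff j = derivative (H.coeff j) := by
  rw [coeffDeriv, Polynomial.finsetSum_coeff]
  simp only [Polynomial.coeff_monomial, Finset.sum_ite_eq', Finset.mem_range]
  split_ifs with h
  · rfl
  · rw [Polynomial.coeff_eq_zero_of_natDegree_lt (by omega), derivative_zero]

/-- `coeffDeriv H` has `t`-degree at most that of `H`. [folklore] -/
theorem natDegree_coeffDeriv_le (H : ℂ[X][X]) : (coeffDeriv H).natDegree ≤ H.natDegree := by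
  rw [coeffDeriv]
  refine Polynomial.natDegree_sum_le_of_forall_le _ _ fun j hj => ?_
  exact (Polynomial.natDegree_monomial_le _).trans (Nat.lt_succ_iff.1 (Finset.mem_range.1 hj))

/-- **The chain rule**: `(F(z, f z))' = (∂_sF)(z, f z) + (∂_tF)(z, f z)·f'(z)`. [folklore] -/
theorem hasDerivAt_evalPP {f : ℂ → ℂ} {f' z : ℂ} (hf : HasDerivAt f f' z) (F : ℂ[X][X]) :
    HasDerivAt (fun y => (F.map (Polynomial.evalRingHom y)).eval (f y))
      (((coeffDeriv F).map (Polynomial.evalRingHom z)).eval (f z) +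
        ((derivative F).map (Polynomial.evalRingHom z)).eval (f z) * f') z := by
  set N := F.natDegree with hN
  have e : (fun y => (F.map (Polynomial.evalRingHom y)).eval (f y)) =
      fun y => ∑ j ∈ Finset.range (N + 1), (F.coeff j).eval y * f y ^ j :=
    funext fun y => evalPP_eq_sum F y (f y) (Nat.lt_succ_self _)
  have hderF : HasDerivAt (fun y => (F.map (Polynomial.evalRingHom y)).eval (f y))
      (∑ j ∈ Finset.range (N + 1), ((derivative (F.coeff j)).eval z * f z ^ j +
        (F.coeff j).eval z * ((j : ℂ) * f z ^ (j - 1) * f'))) z := by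
    rw [e]
    exact HasDerivAt.fun_sum fun j _ => (Polynomial.hasDerivAt (F.coeff j) z).fun_mul (hf.fun_pow j)
  convert hderF using 1
  have hcD : (coeffDeriv F).natDegree < N + 1 := Nat.lt_succ_of_le (natDegree_coeffDeriv_le F)
  have hder : (derivative F).natDegree < N + 1 :=
    Nat.lt_succ_of_le ((Polynomial.natDegree_derivative_le F).trans (Nat.sub_le _ _))
  rw [evalPP_eq_sum _ z (f z) hcD, evalPP_eq_sum _ z (f z) hder, Finset.sum_add_distrib, Finset.sum_mul]
  congr 1
  · refine Finset.sum_congr rfl fun j _ => ?_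
    rw [coeff_coeffDeriv]
  · have hc : F.coeff (N + 1) = 0 := Polynomial.coeff_eq_zero_of_natDegree_lt (by omega)
    calc ∑ j ∈ Finset.range (N + 1), ((derivative F).coeff j).eval z * f z ^ j * f'
        = ∑ j ∈ Finset.range (N + 1), ((j + 1 : ℕ) : ℂ) * (F.coeff (j + 1)).eval z * f z ^ j * f' := by
          refine Finset.sum_congr rfl fun j _ => ?_
          rw [Polynomial.coeff_derivative, Polynomial.eval_mul]
          simp only [Polynomial.eval_add, Polynomial.eval_natCast, Polynomial.eval_one]
          push_cast
          ring
      _ = (∑ j ∈ Finset.range (N + 1), ((j + 1 : ℕ) : ℂ) * (F.coeff (j + 1)).eval z * f z ^ j) * f' := by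
          rw [Finset.sum_mul]
      _ = (∑ j ∈ Finset.range (N + 1), (j : ℂ) * (F.coeff j).eval z * f z ^ (j - 1)) * f' := by
          rw [sum_succ_shift (fun j => (F.coeff j).eval z) (by rw [hc, Polynomial.eval_zero]) (f z)]
      _ = ∑ j ∈ Finset.range (N + 1), (F.coeff j).eval z * ((j : ℂ) * f z ^ (j - 1) * f') := by
          rw [Finset.sum_mul]
          refine Finset.sum_congr rfl fun j _ => ?_
          ring

/-- The germ evaluation as evaluation of the mapped polynomial. [folklore] -/
theorem germEval₂_eq_eval_map {z₀ : ℂ} (v : AGerm z₀) (G : ℂ[X][X]) :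
    germEval₂ z₀ v G =
      (G.map (Polynomial.eval₂RingHom (algebraMap ℂ (AGerm z₀)) (zGerm z₀))).eval v := by
  rw [germEval₂, Polynomial.coe_eval₂RingHom, Polynomial.eval_map]

/-- **The chain rule for germs**: `D(G(zGerm, v)) = (∂_sG)(zGerm, v) + (∂_tG)(zGerm, v)·D v`.
[folklore] -/
theorem AGerm.D_germEval₂ {z₀ : ℂ} (v : AGerm z₀) (G : ℂ[X][X]) :
    AGerm.D (germEval₂ z₀ v G) =
      germEval₂ z₀ v (coeffDeriv G) + germEval₂ z₀ v (derivative G) * AGerm.D v := by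
  obtain ⟨f, hf, rfl⟩ := AGerm.exists_eq_mk v
  rw [germEval₂_mk, germEval₂_mk, germEval₂_mk, AGerm.D_mk, AGerm.D_mk, ← AGerm.mk_mul, ← AGerm.mk_add]
  refine (AGerm.mk_eq_mk_iff _ _).2 ?_
  filter_upwards [hf.eventually_analyticAt] with z hz
  exact (hasDerivAt_evalPP hz.differentiableAt.hasDerivAt G).deriv

/-- Every image of the germ evaluation lies in `ℂ[zGerm, v]`. [folklore] -/
theorem germEval₂_mem_adjoin {z₀ : ℂ} (v : AGerm z₀) (G : ℂ[X][X]) :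
    germEval₂ z₀ v G ∈ Algebra.adjoin ℂ ({zGerm z₀, v} : Set (AGerm z₀)) := by
  set B := Algebra.adjoin ℂ ({zGerm z₀, v} : Set (AGerm z₀)) with hB
  have hzB : zGerm z₀ ∈ B := Algebra.subset_adjoin (by simp)
  have hvB : v ∈ B := Algebra.subset_adjoin (by simp)
  have haevalB : ∀ r : ℂ[X], Polynomial.aeval (zGerm z₀) r ∈ B := fun r =>
    Polynomial.aeval_mem_adjoin_singleton ℂ (zGerm z₀) |> fun h =>
      (Algebra.adjoin_mono (by simp : ({zGerm z₀} : Set (AGerm z₀)) ⊆ {zGerm z₀, v})) h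
  induction G using Polynomial.induction_on' with
  | add p q hp hq => rw [map_add]; exact B.add_mem hp hq
  | monomial n r =>
    rw [germEval₂, Polynomial.coe_eval₂RingHom, Polynomial.eval₂_monomial, Polynomial.coe_eval₂RingHom,
      ← Polynomial.aeval_def]
    exact B.mul_mem (haevalB r) (B.pow_mem hvB n)

/-- Every element of `ℂ[zGerm, v]` is an image of the germ evaluation. [folklore] -/
theorem exists_germEval₂_eq_of_mem_adjoin {z₀ : ℂ} (v : AGerm z₀) {x : AGerm z₀}
    (hx : x ∈ Algebra.adjoin ℂ ({zGerm z₀, v} : Set (AGerm z₀))) :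
    ∃ G : ℂ[X][X], x = germEval₂ z₀ v G := by
  induction hx using Algebra.adjoin_induction with
  | mem x hx =>
    rcases hx with rfl | rfl
    · exact ⟨Polynomial.C Polynomial.X, by rw [germEval₂_C, Polynomial.aeval_X]⟩
    · exact ⟨Polynomial.X, by rw [germEval₂_X]⟩
  | algebraMap r =>
    exact ⟨Polynomial.C (Polynomial.C r), by rw [germEval₂_C, Polynomial.aeval_C]⟩
  | add x y hx hy ihx ihy =>
    obtain ⟨G₁, rfl⟩ := ihx
    obtain ⟨G₂, rfl⟩ := ihy
    exact ⟨G₁ + G₂, by rw [map_add]⟩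
  | mul x y hx hy ihx ihy =>
    obtain ⟨G₁, rfl⟩ := ihx
    obtain ⟨G₂, rfl⟩ := ihy
    exact ⟨G₁ * G₂, by rw [map_mul]⟩

/-! ## Part B. The minimal relation over `ℂ[z, ρ]` and its derivative -/

/-- **The polynomial identity satisfied along the branch by an algebraic primitive of `ρ'/ρ`.**
See the module docstring. [folklore differential algebra (Liouville–Ostrowski)] (new in this form) -/
theorem exists_logRelation_of_algebraic {z₀ : ℂ} (Q : ℂ[X][X]) {ρ L : ℂ → ℂ}
    (hρan : AnalyticAt ℂ ρ z₀) (hLan : AnalyticAt ℂ L z₀) (hρ0 : ρ z₀ ≠ 0)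
    (hQρ : ∀ᶠ z in 𝓝 z₀, (Q.map (Polynomial.evalRingHom z)).eval (ρ z) = 0)
    (hL : ∀ᶠ z in 𝓝 z₀, HasDerivAt L (deriv ρ z / ρ z) z)
    {H : ℂ[X][X]} (hH0 : H ≠ 0) (hH : germEval₂ z₀ (AGerm.mk z₀ hLan) H = 0) :
    ∃ (F G : ℂ[X][X]) (M : ℕ), 1 ≤ M ∧ germEval₂ z₀ (AGerm.mk z₀ hρan) G ≠ 0 ∧
      germEval₂ z₀ (AGerm.mk z₀ hρan)
        (G * (Polynomial.X * (coeffDeriv F * derivative Q - derivative F * coeffDeriv Q) -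
            Polynomial.C (Polynomial.C (M : ℂ)) * coeffDeriv Q * G) -
          Polynomial.X * (coeffDeriv G * derivative Q - derivative G * coeffDeriv Q) * F) = 0 := by
  classical
  set ρO := AGerm.mk z₀ hρan with hρO
  set LO := AGerm.mk z₀ hLan with hLO
  set zO := zGerm z₀ with hzO
  -- the differentiated branch relation: `∂_sQ(ρ) + ∂_tQ(ρ)·Dρ = 0`
  have hQO : germEval₂ z₀ ρO Q = 0 := (germEval₂_mk_eq_zero_iff hρan Q).2 hQρ
  set e : AGerm z₀ := germEval₂ z₀ ρO (derivative Q) with he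
  set qz : AGerm z₀ := germEval₂ z₀ ρO (coeffDeriv Q) with hqz
  have hDQ : qz + e * AGerm.D ρO = 0 := by
    have h := congrArg AGerm.D hQO
    rwa [AGerm.D_germEval₂, AGerm.D_zero] at h
  -- `ρ·DL = Dρ`
  have hρDL : ρO * AGerm.D LO = AGerm.D ρO := by
    rw [hLO, hρO, AGerm.D_mk, AGerm.D_mk, ← AGerm.mk_mul]
    refine (AGerm.mk_eq_mk_iff _ _).2 ?_
    have hne : ∀ᶠ z in 𝓝 z₀, ρ z ≠ 0 := hρan.continuousAt.eventually_ne hρ0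
    filter_upwards [hL, hne] with z hLz hz
    simp only [Pi.mul_apply, hLz.deriv]
    field_simp
  -- the subalgebra `B = ℂ[zGerm, ρ̂]`
  set B : Subalgebra ℂ (AGerm z₀) := Algebra.adjoin ℂ ({zO, ρO} : Set (AGerm z₀)) with hB
  have hzB : zO ∈ B := Algebra.subset_adjoin (by simp)
  have hρB : ρO ∈ B := Algebra.subset_adjoin (by simp)
  have hgermB : ∀ G : ℂ[X][X], germEval₂ z₀ ρO G ∈ B := fun G => germEval₂_mem_adjoin ρO G
  have hrepr : ∀ x ∈ B, ∃ G : ℂ[X][X], x = germEval₂ z₀ ρO G :=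
    fun x hx => exists_germEval₂_eq_of_mem_adjoin ρO hx
  -- `B` is stable under `δ = E·D`, `E = ρ̂·∂_tQ(ρ̂)`
  set E : AGerm z₀ := e * ρO with hE
  have hEB : E ∈ B := B.mul_mem (hgermB _) hρB
  have hδB : ∀ x ∈ B, E * AGerm.D x ∈ B := by
    intro x hx
    obtain ⟨G, rfl⟩ := hrepr x hx
    have hid : E * AGerm.D (germEval₂ z₀ ρO G) =
        ρO * (e * germEval₂ z₀ ρO (coeffDeriv G) - germEval₂ z₀ ρO (derivative G) * qz) := by
      rw [AGerm.D_germEval₂, hE]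
      linear_combination (ρO * germEval₂ z₀ ρO (derivative G)) * hDQ
    rw [hid]
    exact B.mul_mem hρB (B.sub_mem (B.mul_mem (hgermB _) (hgermB _)) (B.mul_mem (hgermB _) (hgermB _)))
  -- `σ = E·DL = -∂_sQ(ρ̂)`
  set σ : AGerm z₀ := E * AGerm.D LO with hσ
  have hσq : σ = -qz := by
    rw [hσ, hE, mul_assoc, hρDL]
    linear_combination hDQ
  have hσB : σ ∈ B := by rw [hσq]; exact B.neg_mem (hgermB _)
  -- a relation over `B` for `L`, from `H`
  have hBval : ∀ x : B, algebraMap B (AGerm z₀) x = (x : AGerm z₀) := by intro x; rfl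
  set φ : ℂ[X] →ₐ[ℂ] B := Polynomial.aeval (⟨zO, hzB⟩ : B) with hφ
  have hφval : ∀ r, ((φ r : B) : AGerm z₀) = Polynomial.aeval zO r := fun r => by
    change B.val (φ r) = _
    rw [hφ, ← Polynomial.aeval_algHom_apply B.val]
    rfl
  have hφinj : Function.Injective φ := by
    intro r r' h
    have h' := congrArg (fun x : B => (x : AGerm z₀)) h
    simp only [hφval] at h'
    exact (transcendental_iff_injective.1 (transcendental_zGerm z₀)) h'
  have hrel : ∃ P : Polynomial B, P ≠ 0 ∧ Polynomial.aeval LO P = 0 := by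
    refine ⟨H.map φ.toRingHom, ?_, ?_⟩
    · intro h0; rw [Polynomial.map_eq_zero_iff hφinj] at h0; exact hH0 h0
    · rw [Polynomial.aeval_def, Polynomial.eval₂_map]
      have hcomp : (algebraMap B (AGerm z₀)).comp φ.toRingHom =
          Polynomial.eval₂RingHom (algebraMap ℂ (AGerm z₀)) zO := by
        refine Polynomial.ringHom_ext (fun c => ?_) ?_
        · rw [RingHom.comp_apply, Polynomial.coe_eval₂RingHom, Polynomial.eval₂_C]
          change ((φ (Polynomial.C c) : B) : AGerm z₀) = _
          rw [hφval, Polynomial.aeval_C]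
        · rw [RingHom.comp_apply, Polynomial.coe_eval₂RingHom, Polynomial.eval₂_X]
          change ((φ Polynomial.X : B) : AGerm z₀) = _
          rw [hφval, Polynomial.aeval_X]
      rw [hcomp]
      exact hH
  -- a minimal one
  obtain ⟨P, hP0, hP, hmin⟩ := exists_minDegree_aeval LO hrel
  set M := P.natDegree with hM
  have hpM : P.coeff M ≠ 0 := Polynomial.leadingCoeff_ne_zero.2 hP0
  have hM1 : 1 ≤ M := by
    by_contra hlt
    have hM0 : M = 0 := by omega
    have hPC : P = Polynomial.C (P.coeff 0) := Polynomial.eq_C_of_natDegree_eq_zero hM0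
    rw [hPC, Polynomial.aeval_C, hBval] at hP
    have h00 : P.coeff 0 = 0 := by exact_mod_cast hP
    rw [hM0] at hpM
    exact hpM h00
  -- the derivation on `B` and the differentiated relation
  set δ : B → B := fun x => ⟨E * AGerm.D (x : AGerm z₀), hδB x x.2⟩ with hδ
  have hδval : ∀ x : B, ((δ x : B) : AGerm z₀) = E * AGerm.D (x : AGerm z₀) := fun x => rfl
  set σB : B := ⟨σ, hσB⟩ with hσB'
  set Pδ : Polynomial B := ∑ j ∈ Finset.range (M + 1), Polynomial.monomial j (δ (P.coeff j)) with hPδ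
  have hcoefPδ : ∀ j, Pδ.coeff j = if j < M + 1 then δ (P.coeff j) else 0 := by
    intro j
    rw [hPδ, Polynomial.finsetSum_coeff]
    simp only [Polynomial.coeff_monomial, Finset.sum_ite_eq', Finset.mem_range]
  set R : Polynomial B := Pδ + Polynomial.C σB * derivative P with hR
  -- `aeval LO R = E · D (aeval LO P) = 0`
  have hRev : Polynomial.aeval LO R = 0 := by
    set Ph : Polynomial (AGerm z₀) := P.map (algebraMap B (AGerm z₀)) with hPh
    have hevP : Polynomial.aeval LO P = Ph.eval LO := by
      rw [Polynomial.aeval_def, hPh, Polynomial.eval_map]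
    have hevdP : Polynomial.aeval LO (derivative P) = (derivative Ph).eval LO := by
      rw [Polynomial.aeval_def, hPh, Polynomial.derivative_map, Polynomial.eval_map]
    have hevPδ : Polynomial.aeval LO Pδ = E * (coeffD Ph).eval LO := by
      have hmap : Pδ.map (algebraMap B (AGerm z₀)) = Polynomial.C E * coeffD Ph := by
        ext j
        rw [Polynomial.coeff_map, hcoefPδ, Polynomial.coeff_C_mul, coeff_coeffD, hPh, Polynomial.coeff_map]
        split_ifs with hj
        · rw [hBval, hδval, hBval]
        · rw [map_zero, hBval, Polynomial.coeff_eq_zero_of_natDegree_lt (by omega)]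
          change (0 : AGerm z₀) = E * AGerm.D ((0 : B) : AGerm z₀)
          rw [ZeroMemClass.coe_zero, AGerm.D_zero, mul_zero]
      rw [Polynomial.aeval_def, ← Polynomial.eval_map, hmap, Polynomial.eval_mul, Polynomial.eval_C]
    have hD0 : AGerm.D (Ph.eval LO) = 0 := by rw [← hevP, hP, AGerm.D_zero]
    calc Polynomial.aeval LO R = E * (coeffD Ph).eval LO + σ * (derivative Ph).eval LO := by
          rw [hR, map_add, map_mul, Polynomial.aeval_C, hBval, hevPδ, hevdP]
      _ = E * ((coeffD Ph).eval LO + (derivative Ph).eval LO * AGerm.D LO) := by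
          rw [hσ]; ring
      _ = 0 := by rw [← AGerm.D_eval, hD0, mul_zero]
  -- the combination of lower degree
  set K : Polynomial B := Polynomial.C (P.coeff M) * R - Polynomial.C (δ (P.coeff M)) * P with hK
  have hKev : Polynomial.aeval LO K = 0 := by
    rw [hK, map_sub, map_mul, map_mul, hRev, hP, mul_zero, mul_zero, sub_zero]
  have hcoefR : ∀ j, R.coeff j = (if j < M + 1 then δ (P.coeff j) else 0) +
      σB * (P.coeff (j + 1) * ((j : B) + 1)) := by
    intro j
    rw [hR, Polynomial.coeff_add, hcoefPδ, Polynomial.coeff_C_mul, Polynomial.coeff_derivative]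
  have hcoefK : ∀ j, M ≤ j → K.coeff j = 0 := by
    intro j hj
    rw [hK, Polynomial.coeff_sub, Polynomial.coeff_C_mul, Polynomial.coeff_C_mul, hcoefR]
    rcases eq_or_lt_of_le hj with h | h
    · rw [← h, if_pos (by omega), Polynomial.coeff_eq_zero_of_natDegree_lt (by omega : P.natDegree < M + 1),
        zero_mul, mul_zero, add_zero]
      ring
    · rw [if_neg (by omega), Polynomial.coeff_eq_zero_of_natDegree_lt (by omega : P.natDegree < j + 1),
        Polynomial.coeff_eq_zero_of_natDegree_lt (by omega : P.natDegree < j), zero_mul, mul_zero,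
        add_zero, mul_zero, mul_zero, sub_zero]
  have hK0 : K = 0 := by
    by_contra hne
    have hdeg : K.natDegree < M := by
      rw [Polynomial.natDegree_lt_iff_degree_lt hne, Polynomial.degree_lt_iff_coeff_zero]
      exact hcoefK
    exact absurd (hmin K hne hKev) (not_le.2 hdeg)
  -- the `t^{M-1}` coefficient
  obtain ⟨M', hMM'⟩ : ∃ M', M = M' + 1 := ⟨M - 1, by omega⟩
  have hstar : P.coeff M * (δ (P.coeff M') + σB * (P.coeff M * ((M' : B) + 1))) -
      δ (P.coeff M) * P.coeff M' = 0 := by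
    have hKM' : K.coeff M' = 0 := by rw [hK0, Polynomial.coeff_zero]
    rw [hK, Polynomial.coeff_sub, Polynomial.coeff_C_mul, Polynomial.coeff_C_mul, hcoefR,
      if_pos (by omega), ← hMM'] at hKM'
    exact hKM'
  -- representations of the two coefficients
  obtain ⟨G, hG⟩ := hrepr _ (P.coeff M).2
  obtain ⟨F, hF⟩ := hrepr _ (P.coeff M').2
  refine ⟨F, G, M, hM1, ?_, ?_⟩
  · -- `G(ρ̂) ≠ 0`
    intro h0
    apply hpM
    have h1 : ((P.coeff M : B) : AGerm z₀) = 0 := by rw [hG]; exact h0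
    exact_mod_cast h1
  · -- the identity in the germ domain
    have hval0 := congrArg (fun x : B => (x : AGerm z₀)) hstar
    have hval : germEval₂ z₀ ρO G * (E * AGerm.D (germEval₂ z₀ ρO F) +
        σ * (germEval₂ z₀ ρO G * ((M' : AGerm z₀) + 1))) -
      E * AGerm.D (germEval₂ z₀ ρO G) * germEval₂ z₀ ρO F = 0 := by
      have h1 : ((δ (P.coeff M') : B) : AGerm z₀) = E * AGerm.D ((P.coeff M' : B) : AGerm z₀) := hδval _
      have h2 : ((δ (P.coeff M) : B) : AGerm z₀) = E * AGerm.D ((P.coeff M : B) : AGerm z₀) := hδval _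
      have h3 : ((σB : B) : AGerm z₀) = σ := rfl
      push_cast [h1, h2, h3] at hval0
      rw [← hG, ← hF]
      linear_combination hval0
    rw [AGerm.D_germEval₂, AGerm.D_germEval₂, hσq, hE] at hval
    have hMc : germEval₂ z₀ ρO (Polynomial.C (Polynomial.C (M : ℂ))) = (M' : AGerm z₀) + 1 := by
      rw [germEval₂_C, Polynomial.aeval_C, hMM']
      push_cast
      rfl
    simp only [map_sub, map_mul, germEval₂_X, hMc]
    rw [← he, ← hqz]
    linear_combination hval - (ρO * germEval₂ z₀ ρO G * germEval₂ z₀ ρO (derivative F) -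
      ρO * germEval₂ z₀ ρO (derivative G) * germEval₂ z₀ ρO F) * hDQ

end Summit.Schanuel.Schanuel.Theorems
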